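import Literature.AnabelianGeometry.EtaleTheta.SettingModelTateCusp
import Literature.AnabelianGeometry.EtaleTheta.SettingModelChiTwistInversion
import HarnessLib

/-!
# The STAGE-2 («Tate shear») model of the [EtTh] §1 root, part F4q-ι: the inversion of `Γ ⋊ G` along the AFFINE
# action — `σ̂` intertwines `Inn(b^m) ∘ shear k ∘ θ_α` only up to an inner `b`-power, and the cocycle-corrected inversion

S. Mochizuki, *The étale theta function …*, Publ. RIMS **45** (2009) [EtTh], §2 p. 36 («`ι` … "multiplication by `−1`"»),
Prop. 2.2 (i) p. 37 [cite: MochizukiEtTh2009, §2 p.36]; [IUTchII] Rmk. 1.4.1 (ii) p. 28 (the pointed inversion is an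
automorphism OVER `G_k`) [cite: Mochizuki2012, Rmk 1.4.1 (ii) p.28].

Cell abc-iut, layer L2, R78 cluster STAGE 2 (integrator abc-iut-L6-d6), seat abc-iut-w5-d249 (gen 5), over this seat's F4q
(`SettingModelTateSemidirect`: `actχq p i j = affTwist₃Gfp ∘ tatePairHom`), F4q-c′ (`SettingModelTateCusp`:
`affTwist₃Gfp_bPowGfp`), abc-iut-L2-t6's F2b/F2c (`shear`, `innB`, `affTwist₃`), abc-iut-w5-d072's stage-1 (R1) file
(`SettingModelChiTwistInversion`: `sigmaHat_bPow`, `sigmaHat_twist`) and abc-iut-L2-t1's `SettingModel2Inversion`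
(`sigmaHat`, `gfpInv`) — consumed BY NAME, nothing restated.

WHAT IS PROVED.  At stage 1 the completed inversion `σ̂ : a ↦ a⁻¹, b ↦ b⁻¹` COMMUTES with the twist, so `(γ, g) ↦ (ι_Γ γ, g)`
is the inversion of `Γ ⋊_{θ∘χ} G` (abc-iut-w5-d072's `twistedInversion`).  At stage 2 it does NOT commute with the affine
action:
* `sigmaHat_innB : σ̂ (Inn(b^t) x) = Inn(b^{t⁻¹}) (σ̂ x)`, `sigmaHat_shear : σ̂ (shear k x) = Inn(b^k) (shear k (σ̂ x))`
  (`σ̂(a·b^k) = a⁻¹b^{−k}` versus `shear k (a⁻¹) = b^{−k}a⁻¹`), hence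
  **`sigmaHat_affTwist₃ : σ̂ (affTwist₃ g x) = Inn(b^{d g}) (affTwist₃ g (σ̂ x))`** with the DEFECT exponent
  `invDefect g := m⁻¹·m⁻¹·k` (`(m, k) = g.left`; additively `k − 2m`), a cocycle: `invDefect (g g') = invDefect g · α_g(invDefect g')`;
* on `Γ`: `gfpInv_affTwist₃Gfp : ι_Γ (affTwist₃Gfp g γ) = (b^{d g}, 0) · affTwist₃Gfp g (ι_Γ γ) · (b^{d g}, 0)⁻¹`;
* **the cocycle-corrected inversion** `tateInversion ρ : (γ, g) ↦ (ι_Γ γ · (b^{d(ρ g)}, 0), g)` of `Γ ⋊_{affTwist₃Gfp ∘ ρ} G`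
  for ANY `ρ : G →* (Ẑ × Ẑ) ⋊_{diag} Ẑ^×`: a group automorphism (`map_mul` by the cocycle law and `σ·(b^t,0) = (b^{χ t},0)`),
  an INVOLUTION (`ι_Γ (b^t, 0) = (b^t, 0)⁻¹`), OVER `G` (`rightHom_tateInversion`), restricting to `ι_Γ` on `Γ`
  (`tateInversion_inl`), reversing the degree `Γ ↠ ℤ` (`gfpSnd_left_tateInversion`), normalising the cusp group
  `b^Ẑ ⋊ G` (`tateInversion_mem_cuspDecomp_iff`), nontrivial, and MOVING the canonical section:
  `ι (inr g) = inl (b^{d(ρ g)}, 0) · inr g` (`tateInversion_inr`) — honestly recorded: the stage-2 inversion is over `G`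
  but not section-fixing; continuous for the induced topology when the coordinates of `ρ` are continuous
  (`continuous_tateInversion`), packaged as `tateInversionTop`;
* the instance at the model: `invDefect (tatePairHom p i j σ) = κ_p(σ)^{−i−i+j}` (`= κ_p^4` at `(i, j) = (−1, 2)`) and
  **`inversionχq p i j : PiTpχq p i j ≃ₜ* PiTpχq p i j`**.
SEMI-SYNTHETIC MODEL, CONSISTENCY EVIDENCE ONLY (not the tempered `π₁` of a curve); nothing of [EtTh] asserted; no side taken
on [IUTchIII] Cor. 3.12; typed ≠ proved.  Definitions: `invDefect`, `tateInversionFun`, `tateInversion`, `tateInversionTop`,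
`inversionχq` (no instances, no Prop facts).
-/

noncomputable section

namespace Literature.AnabelianGeometry.EtaleTheta.SettingModel

open Literature.AnabelianGeometry.SemiGraphs
open Literature.AnabelianGeometry.AbsoluteAnabelian (ZHatCompletion.mul_comm
  ZHatCompletion.exists_continuousMulEquiv_padicProd)
open Function
open _root_.Topology

/-! ## §1. `σ̂` versus the inner `b`-powers, the shear and the affine action -/

/-- **`σ̂ ∘ Inn(b^t) = Inn(b^{t⁻¹}) ∘ σ̂`** (`σ̂(b^t) = b^{−t}`). [cite: MochizukiEtTh2009, §2 p.36] -/
theorem sigmaHat_innB (t : ZH) (x : F₂hatT) : sigmaHat (innB t x) = innB t⁻¹ (sigmaHat x) := by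
  rw [innB_apply, innB_apply, map_mul, map_mul, map_inv sigmaHat, sigmaHat_bPow, map_inv bPow, inv_inv]

/-- **`σ̂ ∘ shear k = Inn(b^k) ∘ shear k ∘ σ̂`**: `σ̂(a·b^k) = a⁻¹·b^{−k}` while `shear k (a⁻¹) = b^{−k}·a⁻¹` — the two agree
up to conjugation by `b^k` (checked on the generators, `ext_of_eta`). [cite: MochizukiEtTh2009, §2 p.36] -/
theorem sigmaHat_shear (k : ZH) (x : F₂hatT) : sigmaHat (shear k x) = innB k (shear k (sigmaHat x)) := by
  let f : F₂hatT →ₜ* F₂hatT :=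
    { toMonoidHom := sigmaHat.toMonoidHom.comp (shearEnd k).toMonoidHom
      continuous_toFun := sigmaHat.continuous.comp (shearEnd k).continuous }
  let f' : F₂hatT →ₜ* F₂hatT :=
    { toMonoidHom := ((innB k).toMulEquiv.toMonoidHom.comp (shearEnd k).toMonoidHom).comp sigmaHat.toMonoidHom
      continuous_toFun := (innB k).continuous.comp ((shearEnd k).continuous.comp sigmaHat.continuous) }
  have hff' : f = f' := by
    refine ext_of_eta ?_ ?_
    · change sigmaHat (shearEnd k (eta (FreeGroup.of 0))) = innB k (shearEnd k (sigmaHat (eta (FreeGroup.of 0))))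
      simp only [shearEnd_eta_of_zero, map_mul, map_inv, sigmaHat_bPow, sigmaHat_eta, invGenHom_of, innB_apply,
        mul_inv_rev]
      group
    · change sigmaHat (shearEnd k (eta (FreeGroup.of 1))) = innB k (shearEnd k (sigmaHat (eta (FreeGroup.of 1))))
      rw [shearEnd_eta_of_one, sigmaHat_eta, invGenHom_of, map_inv, map_inv (shearEnd k), shearEnd_eta_of_one,
        ← bPow_iotaZ_one, ← map_inv bPow, innB_bPow]
  exact DFunLike.congr_fun (congrArg ContinuousMonoidHom.toMonoidHom hff') x

/-- **The inversion defect of the affine action**: `d ⟨(m, k), α⟩ := m⁻¹·m⁻¹·k ∈ Ẑ` (additively `k − 2m`; at the Tate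
pair `(m, k) = (κ_p^i, κ_p^j)` it is `κ_p^{j−2i}`). [cite: MochizukiEtTh2009, §2 p.36] -/
def invDefect (g : (ZH × ZH) ⋊[diagAut] MulAut ZH) : ZH := g.left.1⁻¹ * g.left.1⁻¹ * g.left.2

/-- [cite: MochizukiEtTh2009, §2 p.36] -/
theorem invDefect_apply (g : (ZH × ZH) ⋊[diagAut] MulAut ZH) : invDefect g = g.left.1⁻¹ * g.left.1⁻¹ * g.left.2 := rfl

/-- `d 1 = 1`. [cite: MochizukiEtTh2009, §2 p.36] -/
@[simp] theorem invDefect_one : invDefect 1 = 1 := by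
  rw [invDefect_apply, SemidirectProduct.one_left, Prod.fst_one, Prod.snd_one, inv_one, one_mul, one_mul]

/-- A commutative rearrangement in `Ẑ` (transport through `Ẑ ≃ ∏_p ℤ_p`). [folklore] -/
private theorem zh_rearrange (m k A B : ZH) :
    (m * A)⁻¹ * (m * A)⁻¹ * (k * B) = m⁻¹ * m⁻¹ * k * (A⁻¹ * A⁻¹ * B) := by
  obtain ⟨e, -⟩ := ZHatCompletion.exists_continuousMulEquiv_padicProd
  apply e.injective
  simp only [map_mul, map_inv, mul_inv_rev, mul_assoc, mul_comm, mul_left_comm]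

/-- **The defect is a cocycle** for the cyclotomic part: `d (g g') = d g · α_g (d g')` (`Ẑ` is commutative and `α_g` is
multiplicative). [cite: MochizukiEtTh2009, §2 p.36] -/
theorem invDefect_mul (g g' : (ZH × ZH) ⋊[diagAut] MulAut ZH) :
    invDefect (g * g') = invDefect g * g.right (invDefect g') := by
  simp only [invDefect_apply, SemidirectProduct.mul_left, Prod.fst_mul, Prod.snd_mul, diagAut_apply, map_mul, map_inv]
  exact zh_rearrange _ _ _ _

/-- **`σ̂ ∘ affTwist₃ g = Inn(b^{d g}) ∘ affTwist₃ g ∘ σ̂`**: the completed inversion intertwines the affine action only up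
to the inner `b`-power `b^{k−2m}`. [cite: MochizukiEtTh2009, §2 p.36] -/
theorem sigmaHat_affTwist₃ (g : (ZH × ZH) ⋊[diagAut] MulAut ZH) (x : F₂hatT) :
    sigmaHat (affTwist₃ g x) = innB (invDefect g) (affTwist₃ g (sigmaHat x)) := by
  rw [affTwist₃_apply, affTwist₃_apply, sigmaHat_innB, sigmaHat_shear, sigmaHat_twist, ← innB_mul, ← innB_mul,
    invDefect_apply]
  congr 1
  rw [mul_assoc, ZHatCompletion.mul_comm g.left.2 g.left.1, ← mul_assoc, inv_mul_cancel_right]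

/-- On `Γ`: **`ι_Γ (affTwist₃Gfp g γ) = (b^{d g}, 0) · affTwist₃Gfp g (ι_Γ γ) · (b^{d g}, 0)⁻¹`**.
[cite: MochizukiEtTh2009, §2 p.36] -/
theorem gfpInv_affTwist₃Gfp (g : (ZH × ZH) ⋊[diagAut] MulAut ZH) (γ : Gfp) :
    gfpInv (affTwist₃Gfp g γ) = bPowGfp (invDefect g) * affTwist₃Gfp g (gfpInv γ) * (bPowGfp (invDefect g))⁻¹ := by
  refine Subtype.ext (Prod.ext ?_ ?_)
  · change sigmaHat (affTwist₃ g (γ : F₂hatT × Multiplicative ℤ).1) =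
      bPow (invDefect g) * affTwist₃ g (sigmaHat (γ : F₂hatT × Multiplicative ℤ).1) * (bPow (invDefect g))⁻¹
    rw [sigmaHat_affTwist₃, innB_apply]
  · change ((γ : F₂hatT × Multiplicative ℤ).2)⁻¹ = 1 * ((γ : F₂hatT × Multiplicative ℤ).2)⁻¹ * 1⁻¹
    rw [one_mul, inv_one, mul_one]

/-- `ι_Γ (b^t, 0) = (b^t, 0)⁻¹`. [cite: MochizukiEtTh2009, §2 p.36] -/
theorem gfpInv_bPowGfp (t : ZH) : gfpInv (bPowGfp t) = (bPowGfp t)⁻¹ :=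
  Subtype.ext (Prod.ext (sigmaHat_bPow t) rfl)

/-! ## §2. The cocycle-corrected inversion of `Γ ⋊_{affTwist₃Gfp ∘ ρ} G` -/

section Twisted

variable {G : Type*} [Group G] (ρ : G →* (ZH × ZH) ⋊[diagAut] MulAut ZH)

/-- The defect exponent along `ρ` is a `ρ.right`-cocycle. [cite: MochizukiEtTh2009, §2 p.36] -/
theorem invDefect_rho_mul (g g' : G) : invDefect (ρ (g * g')) = invDefect (ρ g) * (ρ g).right (invDefect (ρ g')) := by
  rw [map_mul, invDefect_mul]

/-- `σ · (b^t, 0) = (b^{α_σ t}, 0)` for the action `affTwist₃Gfp ∘ ρ`. [cite: MochizukiEtTh2009, §1 p.12] -/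
theorem affTwist₃Gfp_comp_bPowGfp (g : G) (t : ZH) :
    (affTwist₃Gfp.comp ρ) g (bPowGfp t) = bPowGfp ((ρ g).right t) :=
  affTwist₃Gfp_bPowGfp (ρ g) t

/-- The underlying function of the stage-2 inversion: `(γ, g) ↦ (ι_Γ γ · (b^{d(ρ g)}, 0), g)`.
[cite: Mochizuki2012, Rmk 1.4.1 (ii) p.28] -/
def tateInversionFun (x : Gfp ⋊[affTwist₃Gfp.comp ρ] G) : Gfp ⋊[affTwist₃Gfp.comp ρ] G :=
  ⟨gfpInv x.left * bPowGfp (invDefect (ρ x.right)), x.right⟩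

/-- [cite: Mochizuki2012, Rmk 1.4.1 (ii) p.28] -/
@[simp] theorem tateInversionFun_left (x : Gfp ⋊[affTwist₃Gfp.comp ρ] G) :
    (tateInversionFun ρ x).left = gfpInv x.left * bPowGfp (invDefect (ρ x.right)) := rfl

/-- [cite: Mochizuki2012, Rmk 1.4.1 (ii) p.28] -/
@[simp] theorem tateInversionFun_right (x : Gfp ⋊[affTwist₃Gfp.comp ρ] G) : (tateInversionFun ρ x).right = x.right := rfl

/-- **The corrected inversion is an involution** (`ι_Γ (b^t,0) = (b^t,0)⁻¹`). [cite: MochizukiEtTh2009, §2 p.36] -/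
theorem tateInversionFun_tateInversionFun (x : Gfp ⋊[affTwist₃Gfp.comp ρ] G) :
    tateInversionFun ρ (tateInversionFun ρ x) = x := by
  refine SemidirectProduct.ext ?_ rfl
  rw [tateInversionFun_left, tateInversionFun_left, tateInversionFun_right, map_mul, gfpInv_bPowGfp,
    inv_mul_cancel_right]
  exact gfpInvFun_gfpInvFun x.left

/-- **The corrected inversion is multiplicative** — the cocycle law of the defect and `σ·(b^t,0) = (b^{α_σ t},0)`
compensate the inner `b`-power by which `ι_Γ` fails to commute with the affine action. [cite: Mochizuki2012, Rmk 1.4.1 (ii) p.28] -/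
theorem tateInversionFun_mul (x y : Gfp ⋊[affTwist₃Gfp.comp ρ] G) :
    tateInversionFun ρ (x * y) = tateInversionFun ρ x * tateInversionFun ρ y := by
  refine SemidirectProduct.ext ?_ ?_
  · rw [SemidirectProduct.mul_left, tateInversionFun_left, tateInversionFun_left, tateInversionFun_left,
      tateInversionFun_right, SemidirectProduct.mul_left, SemidirectProduct.mul_right, map_mul gfpInv,
      invDefect_rho_mul, map_mul bPowGfp, map_mul ((affTwist₃Gfp.comp ρ) x.right), affTwist₃Gfp_comp_bPowGfp]
    change gfpInv x.left * gfpInv (affTwist₃Gfp (ρ x.right) y.left) *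
        (bPowGfp (invDefect (ρ x.right)) * bPowGfp ((ρ x.right).right (invDefect (ρ y.right)))) =
      gfpInv x.left * bPowGfp (invDefect (ρ x.right)) *
        (affTwist₃Gfp (ρ x.right) (gfpInv y.left) * bPowGfp ((ρ x.right).right (invDefect (ρ y.right))))
    rw [gfpInv_affTwist₃Gfp]
    group
  · rw [tateInversionFun_right, SemidirectProduct.mul_right, SemidirectProduct.mul_right, tateInversionFun_right,
      tateInversionFun_right]

/-- **The inversion of `Γ ⋊_{affTwist₃Gfp ∘ ρ} G`** (stage 2): `(γ, g) ↦ (ι_Γ γ · (b^{d(ρ g)}, 0), g)`, a group automorphism,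
its own inverse. Generic in `(G, ρ)`; at the model `ρ := tatePairHom p i j`. DEFINED. [cite: Mochizuki2012, Rmk 1.4.1 (ii) p.28] -/
def tateInversion : (Gfp ⋊[affTwist₃Gfp.comp ρ] G) ≃* (Gfp ⋊[affTwist₃Gfp.comp ρ] G) where
  toFun := tateInversionFun ρ
  invFun := tateInversionFun ρ
  left_inv := tateInversionFun_tateInversionFun ρ
  right_inv := tateInversionFun_tateInversionFun ρ
  map_mul' := tateInversionFun_mul ρ

/-- [cite: Mochizuki2012, Rmk 1.4.1 (ii) p.28] -/
@[simp] theorem tateInversion_left (x : Gfp ⋊[affTwist₃Gfp.comp ρ] G) :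
    (tateInversion ρ x).left = gfpInv x.left * bPowGfp (invDefect (ρ x.right)) := rfl

/-- [cite: Mochizuki2012, Rmk 1.4.1 (ii) p.28] -/
@[simp] theorem tateInversion_right (x : Gfp ⋊[affTwist₃Gfp.comp ρ] G) : (tateInversion ρ x).right = x.right := rfl

/-- **Involution.** [cite: MochizukiEtTh2009, §2 p.36] -/
@[simp] theorem tateInversion_tateInversion (x : Gfp ⋊[affTwist₃Gfp.comp ρ] G) :
    tateInversion ρ (tateInversion ρ x) = x :=
  tateInversionFun_tateInversionFun ρ x

/-- **Over `G`**: `rightHom ∘ ι = rightHom`. [cite: Mochizuki2012, Rmk 1.4.1 (ii) p.28] -/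
theorem rightHom_tateInversion (x : Gfp ⋊[affTwist₃Gfp.comp ρ] G) :
    SemidirectProduct.rightHom (tateInversion ρ x) = SemidirectProduct.rightHom x := rfl

/-- On the normal factor the inversion is `ι_Γ`: `ι (inl γ) = inl (ι_Γ γ)` (`d(ρ 1) = 1`). [cite: MochizukiEtTh2009, §2 p.36] -/
theorem tateInversion_inl (γ : Gfp) :
    tateInversion ρ (SemidirectProduct.inl γ) = SemidirectProduct.inl (gfpInv γ) := by
  refine SemidirectProduct.ext ?_ rfl
  rw [tateInversion_left, SemidirectProduct.left_inl, SemidirectProduct.right_inl, map_one, invDefect_one, map_one,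
    mul_one, SemidirectProduct.left_inl]

/-- **The canonical section is MOVED by the defect cocycle**: `ι (inr g) = inl (b^{d(ρ g)}, 0) · inr g` — the stage-2
inversion is over `G` but not section-fixing (honest record). [cite: Mochizuki2012, Rmk 1.4.1 (ii) p.28] -/
theorem tateInversion_inr (g : G) :
    tateInversion ρ (SemidirectProduct.inr g) =
      SemidirectProduct.inl (bPowGfp (invDefect (ρ g))) * SemidirectProduct.inr g := by
  refine SemidirectProduct.ext ?_ ?_
  · rw [tateInversion_left, SemidirectProduct.left_inr, SemidirectProduct.right_inr, map_one, one_mul,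
      SemidirectProduct.mul_left, SemidirectProduct.left_inl, SemidirectProduct.right_inl, map_one, MulAut.one_apply,
      SemidirectProduct.left_inr, mul_one]
  · rw [tateInversion_right, SemidirectProduct.right_inr, SemidirectProduct.mul_right, SemidirectProduct.right_inl,
      SemidirectProduct.right_inr, one_mul]

/-- **Degree reversal**: `pr₂ (ι x).left = (pr₂ x.left)⁻¹` (the `b`-axis has degree `0`). [cite: Mochizuki2012, Prop 2.2 (ii) p.66] -/
theorem gfpSnd_left_tateInversion (x : Gfp ⋊[affTwist₃Gfp.comp ρ] G) :
    gfpSnd (tateInversion ρ x).left = (gfpSnd x.left)⁻¹ := by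
  rw [tateInversion_left, map_mul, gfpSnd_bPowGfp, mul_one]
  rfl

/-- **The inversion is nontrivial** (it moves `inl (a)`: degree `1 ≠ −1`). [cite: MochizukiEtTh2009, §2 p.36] -/
theorem tateInversion_ne_refl : tateInversion ρ ≠ MulEquiv.refl _ := by
  intro h
  have h1 := gfpSnd_left_tateInversion ρ (SemidirectProduct.inl (gfpOf (FreeGroup.of 0)))
  rw [h] at h1
  change expA (FreeGroup.of 0) = (expA (FreeGroup.of 0))⁻¹ at h1
  rw [expA_apply, heisHom_of_zero, ← ofAdd_neg] at h1
  have h2 : (1 : ℤ) = -1 := Multiplicative.ofAdd.injective h1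
  omega

/-- **The inversion normalises the cusp group** `D = b^Ẑ ⋊ G`: `ι x ∈ D ↔ x ∈ D` (`D = {x | x.left ∈ b^Ẑ}` for any
axis-stabilising action). [cite: MochizukiSemiAnbd2006, §6 p.71] -/
theorem tateInversion_mem_cuspDecomp_iff
    (hρ : ∀ (g : G) {q : Gfp}, q ∈ bAxisGfp → (affTwist₃Gfp.comp ρ) g q ∈ bAxisGfp)
    (x : Gfp ⋊[affTwist₃Gfp.comp ρ] G) :
    tateInversion ρ x ∈ cuspDecomp (affTwist₃Gfp.comp ρ) hρ ↔ x ∈ cuspDecomp (affTwist₃Gfp.comp ρ) hρ := by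
  rw [mem_cuspDecomp_iff, mem_cuspDecomp_iff, tateInversion_left]
  constructor
  · intro h
    have h' : gfpInv x.left ∈ bAxisGfp := by
      have := mul_mem h (inv_mem (bPowGfp_mem_bAxisGfp (invDefect (ρ x.right))))
      rwa [mul_inv_cancel_right] at this
    obtain ⟨t, ht⟩ := h'
    refine ⟨t⁻¹, ?_⟩
    change bPowGfp t⁻¹ = x.left
    rw [map_inv, ← gfpInv_bPowGfp]
    change gfpInv (bPowGfp.toMonoidHom t) = x.left
    rw [ht]
    exact gfpInvFun_gfpInvFun x.left
  · rintro ⟨t, ht⟩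
    refine mul_mem ?_ (bPowGfp_mem_bAxisGfp _)
    rw [← ht]
    change gfpInv (bPowGfp t) ∈ bAxisGfp
    rw [gfpInv_bPowGfp]
    exact inv_mem (bPowGfp_mem_bAxisGfp t)

/-- **Continuity** for any topology on `Γ ⋊ G` INDUCED by `g ↦ (g.left, g.right)`, provided the coordinates of `ρ` are
continuous (`G → Ẑ`). [cite: MochizukiEtTh2009, §2 p.36] -/
theorem continuous_tateInversion [TopologicalSpace G] [TopologicalSpace (Gfp ⋊[affTwist₃Gfp.comp ρ] G)]
    (hind : IsInducing fun g : Gfp ⋊[affTwist₃Gfp.comp ρ] G => (g.left, g.right))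
    (hm : Continuous fun σ => (ρ σ).left.1) (hk : Continuous fun σ => (ρ σ).left.2) :
    Continuous (tateInversion ρ) := by
  rw [hind.continuous_iff]
  have hd : Continuous fun σ : G => invDefect (ρ σ) := (hm.inv.mul hm.inv).mul hk
  have hl : Continuous fun g : Gfp ⋊[affTwist₃Gfp.comp ρ] G => g.left := continuous_fst.comp hind.continuous
  have hr : Continuous fun g : Gfp ⋊[affTwist₃Gfp.comp ρ] G => g.right := continuous_snd.comp hind.continuous
  change Continuous fun g : Gfp ⋊[affTwist₃Gfp.comp ρ] G =>
    (gfpInv g.left * bPowGfp (invDefect (ρ g.right)), g.right)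
  exact ((gfpInv.continuous.comp hl).mul (bPowGfp.continuous.comp (hd.comp hr))).prodMk hr

/-- **The stage-2 inversion as a TOPOLOGICAL automorphism** of `Γ ⋊ G` (topology induced by `(left, right)`).
[cite: Mochizuki2012, Rmk 1.4.1 (ii) p.28] -/
def tateInversionTop [TopologicalSpace G] [TopologicalSpace (Gfp ⋊[affTwist₃Gfp.comp ρ] G)]
    (hind : IsInducing fun g : Gfp ⋊[affTwist₃Gfp.comp ρ] G => (g.left, g.right))
    (hm : Continuous fun σ => (ρ σ).left.1) (hk : Continuous fun σ => (ρ σ).left.2) :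
    (Gfp ⋊[affTwist₃Gfp.comp ρ] G) ≃ₜ* (Gfp ⋊[affTwist₃Gfp.comp ρ] G) where
  toMulEquiv := tateInversion ρ
  continuous_toFun := continuous_tateInversion ρ hind hm hk
  continuous_invFun := by
    have h : ((tateInversion ρ).symm : Gfp ⋊[affTwist₃Gfp.comp ρ] G → _) = tateInversion ρ := by
      funext x
      apply (tateInversion ρ).injective
      rw [MulEquiv.apply_symm_apply, tateInversion_tateInversion]
    change Continuous ((tateInversion ρ).symm : Gfp ⋊[affTwist₃Gfp.comp ρ] G → _)
    rw [h]
    exact continuous_tateInversion ρ hind hm hk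

/-- [cite: Mochizuki2012, Rmk 1.4.1 (ii) p.28] -/
@[simp] theorem tateInversionTop_apply [TopologicalSpace G] [TopologicalSpace (Gfp ⋊[affTwist₃Gfp.comp ρ] G)]
    (hind : IsInducing fun g : Gfp ⋊[affTwist₃Gfp.comp ρ] G => (g.left, g.right))
    (hm : Continuous fun σ => (ρ σ).left.1) (hk : Continuous fun σ => (ρ σ).left.2)
    (x : Gfp ⋊[affTwist₃Gfp.comp ρ] G) : tateInversionTop ρ hind hm hk x = tateInversion ρ x := rfl

end Twisted

/-! ## §3. The instance at the stage-2 model `PiTpχq p i j` -/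

variable (p : ℕ) [Fact p.Prime] (i j : ℤ)

/-- The defect along the Tate pair: `d (tatePairHom σ) = κ_p(σ)^{−i} · κ_p(σ)^{−i} · κ_p(σ)^{j} = κ_p(σ)^{−i−i+j}`
(`κ_p^4` at `(i, j) = (−1, 2)`). [cite: MochizukiEtTh2009, §2 p.36] -/
theorem invDefect_tatePairHom (σ : GQp p) : invDefect (tatePairHom p i j σ) = kappaP p σ ^ (-i + -i + j) := by
  rw [invDefect_apply, zpow_add, zpow_add, zpow_neg]
  rfl

/-- **The inversion of the stage-2 model** `ι_χq : Π^tp_X ≃ₜ* Π^tp_X`, `(γ, σ) ↦ (ι_Γ γ · (b^{κ_p(σ)^{j−2i}}, 0), σ)`.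
[cite: Mochizuki2012, Rmk 1.4.1 (ii) p.28] -/
def inversionχq : PiTpχq p i j ≃ₜ* PiTpχq p i j :=
  tateInversionTop (tatePairHom p i j) (isInducing_leftRightχq p i j) (continuous_kappaP_zpow p i)
    (continuous_kappaP_zpow p j)

/-- [cite: Mochizuki2012, Rmk 1.4.1 (ii) p.28] -/
theorem inversionχq_apply (x : PiTpχq p i j) : inversionχq p i j x = tateInversion (tatePairHom p i j) x := rfl

/-- `ι_χq` is an involution. [cite: MochizukiEtTh2009, §2 p.36] -/
theorem inversionχq_inversionχq (x : PiTpχq p i j) : inversionχq p i j (inversionχq p i j x) = x :=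
  tateInversion_tateInversion _ x

/-- `ι_χq` is over `G_{ℚ_p}`: `aug ∘ ι = aug`. [cite: Mochizuki2012, Rmk 1.4.1 (ii) p.28] -/
theorem augχq_inversionχq (x : PiTpχq p i j) : augχq p i j (inversionχq p i j x) = augχq p i j x := rfl

/-- `ι_χq` restricts to `ι_Γ` on `Γ = Δ^tp_X·`-part: `ι (inl γ) = inl (ι_Γ γ)`. [cite: MochizukiEtTh2009, §2 p.36] -/
theorem inversionχq_inl (γ : Gfp) :
    inversionχq p i j (SemidirectProduct.inl γ) = SemidirectProduct.inl (gfpInv γ) :=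
  tateInversion_inl _ γ

/-- `ι_χq` reverses the degree `Γ ↠ ℤ`. [cite: Mochizuki2012, Prop 2.2 (ii) p.66] -/
theorem gfpSnd_left_inversionχq (x : PiTpχq p i j) : gfpSnd (inversionχq p i j x).left = (gfpSnd x.left)⁻¹ :=
  gfpSnd_left_tateInversion _ x

/-- `ι_χq` maps `Δ^tp_X` to itself. [cite: MochizukiEtTh2009, §2 p.36] -/
theorem inversionχq_mem_deltaTemp_iff (x : PiTpχq p i j) :
    inversionχq p i j x ∈ (curveχq p i j).DeltaTemp ↔ x ∈ (curveχq p i j).DeltaTemp := Iff.rfl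

/-- `ι_χq` normalises the cusp decomposition group `b^Ẑ ⋊ G_{ℚ_p}` of `curveχq′`. [cite: MochizukiSemiAnbd2006, §6 p.71] -/
theorem inversionχq_mem_cuspDecompχq_iff (x : PiTpχq p i j) :
    inversionχq p i j x ∈ cuspDecompχq p i j ↔ x ∈ cuspDecompχq p i j :=
  tateInversion_mem_cuspDecomp_iff _ (actχq_stabilises p i j) x

/-- `ι_χq` moves the canonical section by the Kummer cocycle `b^{κ_p^{j−2i}}`. [cite: Mochizuki2012, Rmk 1.4.1 (ii) p.28] -/
theorem inversionχq_inr (σ : GQp p) :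
    inversionχq p i j (SemidirectProduct.inr σ) =
      SemidirectProduct.inl (bPowGfp (kappaP p σ ^ (-i + -i + j))) * SemidirectProduct.inr σ := by
  rw [inversionχq_apply, tateInversion_inr, invDefect_tatePairHom]

/-- `ι_χq ≠ id`. [cite: MochizukiEtTh2009, §2 p.36] -/
theorem inversionχq_ne_refl : (inversionχq p i j).toMulEquiv ≠ MulEquiv.refl _ := tateInversion_ne_refl _

end Literature.AnabelianGeometry.EtaleTheta.SettingModel

end
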